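import Summits.Ventures.WeilGRH.TwistedGramCellCheckRowsE
import HarnessLib

/-!
# GRH arm (rh-explicit, venture WeilGRH): COLUMN-SPLIT cell checker for the door-E EVEN sector of the twisted format-C χ-cells

Cell `rh-explicit`, WEIL TRACK — GRH ARM (weil-grh-1 gen10; the column-level refinement of gen8's `TwistedGramCellCheckRowsE.lean`).
`checkCellERows … i 1` evaluates the `B` entries of ONE row of an even cell in one `decide +kernel`; each entry is a Schur complement over the
`B₃ − B` far columns, and at the rung-six window `(log 12)/2` (eight prime powers, far block `B₃ = 127`) a whole row already sits at the
kernel's memory guard.  This file splits a row by COLUMNS without touching the mathematics: `checkCellECols … i j₀ n` checks the entries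
`(i, j)` for `j₀ ≤ j < j₀ + n` only (glued by `checkCellECols_append` / `_glue`), and `checkCellERows_of_cols` reassembles the one-row range
`checkCellERows … i 1 = true` from a column range `[0, n)`, `n ≥ B` — so `checkCellERows_glue` / `checkCellE_of_rows` and the soundness theorem
`hSe_of_checkCellE` apply verbatim.  Pure Boolean bookkeeping; RH/GRH-free; standard axioms.  Reference for the enclosure semantics:
R. E. Moore (1966) Ch. 3 [Moore1966].
-/

namespace Summit.Ventures.WeilGRH

namespace TwistedEncl
open Literature.NumberTheory.LFunctions Literature.NumberTheory.LFunctions.Yoshida1992 Encl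
open Literature.Analysis.ValidatedNumerics.NumericsMP

variable {S : ℕ}

/-! ## Even sector (door E), one row by column ranges -/

/-- The entries `(i, j)`, `j₀ ≤ j < j₀ + n`, of row `i` of the cell check `checkCellE` (entry enclosures only).
[cite: Moore1966, Ch. 3 (interval arithmetic: inclusion property)] -/
def checkCellECols (S : ℕ) (C : Consts) (εs : List ℤ) (LQ : MI) (tab : List IdxRec) (d : EvenCellData) (c : ℕ) (ρ : ℤ)
    (D : List (List ℤ)) (i j0 n : ℕ) : Bool :=
  (List.range' j0 n).all fun j ↦ enclCheck S c ρ (PsdDyadic.getMZ D i j) (cellE S C εs LQ tab d i j)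

/-- Semantics of a column range. [cite: Moore1966, Ch. 3 (interval arithmetic: inclusion property)] -/
theorem checkCellECols_iff {C : Consts} {εs : List ℤ} {LQ : MI} {tab : List IdxRec} {d : EvenCellData} {c : ℕ} {ρ : ℤ}
    {D : List (List ℤ)} {i j0 n : ℕ} :
    checkCellECols S C εs LQ tab d c ρ D i j0 n = true ↔
      ∀ j, j0 ≤ j → j < j0 + n → enclCheck S c ρ (PsdDyadic.getMZ D i j) (cellE S C εs LQ tab d i j) = true := by
  unfold checkCellECols
  simp only [List.all_eq_true, List.mem_range'_1, and_imp]

/-- Consecutive column ranges glue. [cite: Moore1966, Ch. 3 (interval arithmetic: inclusion property)] -/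
theorem checkCellECols_append {C : Consts} {εs : List ℤ} {LQ : MI} {tab : List IdxRec} {d : EvenCellData} {c : ℕ} {ρ : ℤ}
    {D : List (List ℤ)} {i j0 n1 n2 : ℕ} (h1 : checkCellECols S C εs LQ tab d c ρ D i j0 n1 = true)
    (h2 : checkCellECols S C εs LQ tab d c ρ D i (j0 + n1) n2 = true) :
    checkCellECols S C εs LQ tab d c ρ D i j0 (n1 + n2) = true := by
  rw [checkCellECols_iff] at h1 h2 ⊢
  intro j hj1 hj2
  by_cases h : j < j0 + n1
  · exact h1 j hj1 h
  · exact h2 j (by omega) (by omega)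

/-- Consecutive column ranges glue — all indices literal. [folklore] -/
theorem checkCellECols_glue {C : Consts} {εs : List ℤ} {LQ : MI} {tab : List IdxRec} {d : EvenCellData} {c : ℕ} {ρ : ℤ}
    {D : List (List ℤ)} {i j0 n1 j1 n2 n : ℕ} (h1 : checkCellECols S C εs LQ tab d c ρ D i j0 n1 = true)
    (h2 : checkCellECols S C εs LQ tab d c ρ D i j1 n2 = true) (hj : j1 = j0 + n1) (hn : n = n1 + n2) :
    checkCellECols S C εs LQ tab d c ρ D i j0 n = true := by
  subst hj hn; exact checkCellECols_append h1 h2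

/-- ★ Reassembly of ONE row: a column range `[0, n)` with `n ≥ B` gives the one-row range `checkCellERows … i 1 = true`
(so `checkCellERows_glue` and `checkCellE_of_rows` apply verbatim). [cite: Moore1966, Ch. 3 (interval arithmetic: inclusion property)] -/
theorem checkCellERows_of_cols {C : Consts} {εs : List ℤ} {LQ : MI} {tab : List IdxRec} {d : EvenCellData} {c : ℕ} {ρ : ℤ}
    {D : List (List ℤ)} {i n : ℕ} (h : checkCellECols S C εs LQ tab d c ρ D i 0 n = true) (hn : d.B ≤ n) :
    checkCellERows S C εs LQ tab d c ρ D i 1 = true := by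
  rw [checkCellECols_iff] at h
  rw [checkCellERows_iff]
  intro i' hi1 hi2 j hj
  obtain rfl : i' = i := by omega
  exact h j (Nat.zero_le j) (by omega)

end TwistedEncl

end Summit.Ventures.WeilGRH
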